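import Literature.AlgebraicGeometry.Motives.HodgeThetaSubalgebraPerfect
import Literature.AlgebraicGeometry.Motives.HodgeStructureEndAlgSemisimple
import Literature.Algebra.Lie.TraceSeparatingCenterDerived
import HarnessLib

/-!
# Rational Lie algebras inside `𝔰𝔭_E(V, ψ)` containing `Θ` are REDUCTIVE: `𝔤 = 𝔷(𝔤) ⊕ [𝔤, 𝔤]`, with `𝔷(𝔤) = 𝔤 ∩ End_Hdg(V)` and `[𝔤, 𝔤]` perfect, centre-free and trace-non-degenerate (Deligne LNM 900 I Prop. 3.6; Moonen–Zarhin 1999 §1 — Lie-algebra form)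

Family `hodge`, layer `Literature/AlgebraicGeometry/Motives` (abstract polarizable `ℚ`-Hodge structures; no
geometry). Written for the cell `pub-hodgecm2` (COR-CM), seat `b27` (count-neutral own lane MT-REDUCTIVE, sequel of
the foundational lemma `𝔪𝔱 = 𝔥 ⊕ ℚ·id` of `MumfordTateLieAlgebraEqHodgeLie`); UNCONDITIONAL linear algebra, theorems
only (no definition, no named fact, D-0026); no step towards a summit statement. It is the sequel of
`HodgeThetaSubalgebraPerfect` (seat `lit-milne`), which proves that the trace form `tr(XY)` of `V` is
non-degenerate on every bracket-closed rational `𝔤 ⊆ 𝔰𝔭(V, ψ)` whose complexification contains the Hodge operator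
(`eq_zero_of_forall_trace_mul_eq_zero`) and that `𝔤 = [𝔤, 𝔤]` WHEN the centre vanishes; here the centre is allowed.

PRINTED RESULTS, Lie-algebra form.
* P. Deligne, *Hodge cycles on abelian varieties*, LNM 900 (1982), I Prop. 3.6 (held, re-ed. p. 25): «Let `(V, h)`
  be a polarizable rational Hodge structure; then `MT(V, h)` is reductive» (proof: `ad C` is a Cartan involution,
  the Hodge form `ψ(x, C ȳ)` is positive definite).
* B. Moonen, Yu. Zarhin, *Hodge classes on abelian varieties of low dimension*, Math. Ann. 315 (1999) §1 (held
  `paper:arxiv-math_9901113` p. 2): «The Hodge group `Hg(X)` is a connected reductive algebraic group … the centre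
  of `Hg(X)` is contained in … the centre `F` of `End⁰(X)` … If `X` has no factors of Type 4 then `Hg(X)` is
  semi-simple».
* J. E. Humphreys, *Introduction to Lie algebras and representation theory*, GTM 9, §5.1–§5.2 and §19.1
  («reductive: `L = Z(L) ⊕ [L, L]`, `[L, L]` semisimple»), §6.2 (non-degenerate invariant forms).

THIS FILE. Let `H` be an effective polarizable `ℚ`-Hodge structure of weight `1` on a finite-dimensional `V`
(the `H¹` of a complex abelian variety), `ψ` a polarization, `Θ` the Hodge operator, and `𝔤 ⊆ End_ℚ(V)` ANY
bracket-closed rational subspace of `ψ`-skew operators with `Θ ∈ 𝔤_ℂ = spanC 𝔤` (e.g. `𝔤 = Lie Hg(H) = hodgeLie H`).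
Write `𝔷(𝔤) = 𝔤 ⊓ centralizer(𝔤)` (the centre, an explicit `Submodule`: `𝔤 ⊓ Subalgebra.toSubmodule
(Subalgebra.centralizer ℚ 𝔤)`) and `𝔡(𝔤) = span_ℚ {XY - YX : X, Y ∈ 𝔤}` (the derived algebra, as in
`HodgeThetaSubalgebraPerfect`). No notion is introduced: both are spelled out in every statement.

* §1 (imported, `Literature/Algebra/Lie/TraceSeparatingCenterDerived`, namespace `TraceSeparating`) PURE LINEAR
  ALGEBRA over a field `K`: for a bracket-closed `𝔤 ⊆ End_K(W)` with SEPARATING trace form,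
  `dim 𝔷(𝔤) + dim 𝔡(𝔤) = dim 𝔤`, and if the trace form is anisotropic on the centre then `𝔤 = 𝔷(𝔤) ⊕ 𝔡(𝔤)` with
  `𝔡(𝔤)` perfect, centre-free and trace-separating.
* §2 HODGE INPUT (any weight, this file): `trace_mul_self_lt_zero_of_central` — a NON-ZERO CENTRAL element `Z` of a rational
  `𝔤 ⊆ 𝔰𝔭(V,ψ)` with `Θ ∈ 𝔤_ℂ` has `tr(Z²) < 0`: it is a Hodge endomorphism (`mem_endAlg_of_mem_center`: it
  commutes with `Θ`), it is `ψ`-skew, so its Rosati adjoint is `Z† = -Z` and `tr(Z²) = -tr(Z Z†) < 0` by the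
  positivity of the Rosati involution (`Polarization.trace_mul_adjoint_self_pos`). Hence the trace form is
  anisotropic (negative definite) on the centre (`eq_zero_of_central_of_trace_mul_self_eq_zero`), and
  `center_eq_inf_endAlg`: if `𝔤` commutes with `End_Hdg(V)` then `𝔷(𝔤) = 𝔤 ⊓ End_Hdg(V)`.
* §3 MAIN THEOREMS (effective weight one, where `HodgeThetaSubalgebraPerfect` supplies the separating trace form):
  **`ThetaSubalgebra.center_sup_derived_eq`** / `…center_inf_derived_eq_bot` / `…finrank_center_add_finrank_derived`
  / `…derived_eq_span_commutators_derived` / `…eq_zero_of_mem_derived_of_forall_commute` /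
  `…eq_zero_of_mem_derived_of_forall_trace_mul_eq_zero` — `𝔤 = 𝔷(𝔤) ⊕ 𝔡(𝔤)` with `𝔡(𝔤)` perfect, centre-free
  and trace-non-degenerate («`𝔤` is reductive», Deligne I 3.6 / Humphreys §19.1, minus the word «semisimple», which
  is the sequel `HodgeThetaSubalgebraSemisimple`); and the instances for `𝔤 = hodgeLie H`:
  **`hodgeLie_center_sup_derived_eq`**, `hodgeLie_center_inf_derived_eq_bot`, `finrank_hodgeLie_eq_center_add_derived`,
  **`hodgeLie_center_eq_inf_endAlg`** («the centre of `Lie Hg` lies in (the `ψ`-skew part of the centre of)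
  `End_Hdg(V)`», Moonen–Zarhin §1), `hodgeLie_derived_perfect`, `hodgeLie_derived_center_trivial`.

What is NOT here: semisimplicity of `𝔡(𝔤)` (no abelian ideals) — the sequel; algebraic groups; abelian varieties
(the CorCM layer reads `hodgeLie (H¹ X)`).
-/

noncomputable section

open scoped TensorProduct

namespace Literature.AlgebraicGeometry.Motives

namespace HodgeStructure

universe u

/-! ### §2 Hodge input (§1 is `Literature/Algebra/Lie/TraceSeparatingCenterDerived`): the trace form is negative definite on the centre; the centre is `𝔤 ∩ End_Hdg(V)` -/

section Hodge

variable {V : Type u} [AddCommGroup V] [Module ℚ V] [Module.Finite ℚ V] {n : ℤ}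

/-- **A non-zero central element of a rational `𝔤 ⊆ 𝔰𝔭(V, ψ)` with `Θ ∈ 𝔤_ℂ` has `tr(Z²) < 0`** (any weight): `Z`
is a Hodge endomorphism (`mem_endAlg_of_mem_center`), it is `ψ`-skew, so its Rosati adjoint is `Z† = -Z`
(`Polarization.eq_adjoint_of_isAdjointPair`), and `tr(Z Z†) > 0` (`Polarization.trace_mul_adjoint_self_pos`:
positivity of the Rosati involution, second Hodge–Riemann relation). «The centre of `Hg` is a torus of `End⁰`
on which the Rosati involution acts by inversion» (Moonen–Zarhin §1). [cite: MoonenZarhin1999LowDim, §1]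
[cite: Deligne1982HodgeCycles, I §3 Prop. 3.6] -/
theorem trace_mul_self_lt_zero_of_central (H : HodgeStructure V n) (ψ : H.Polarization)
    (𝔤 : Submodule ℚ (Module.End ℚ V))
    {Θ : Module.End ℂ (ℂ ⊗[ℚ] V)} (hΘ : ∀ p, ∀ x ∈ H.piece p (n - p), Θ x = ((2 * p - n : ℤ) : ℂ) • x)
    (hΘ𝔤 : Θ ∈ spanC 𝔤)
    (hskew : ∀ X ∈ 𝔤, ∀ v w, ψ.form (X v) w + ψ.form v (X w) = 0)
    {Z : Module.End ℚ V} (hZ : Z ∈ 𝔤) (hZc : ∀ Y ∈ 𝔤, Z * Y = Y * Z) (hZ0 : Z ≠ 0) :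
    LinearMap.trace ℚ V (Z * Z) < 0 := by
  have hZE : Z ∈ H.endAlg := mem_endAlg_of_mem_center H 𝔤 hΘ hΘ𝔤 hZc
  have hadj : ψ.adjoint Z = -Z := by
    refine (ψ.eq_adjoint_of_isAdjointPair fun v w => ?_).symm
    rw [LinearMap.neg_apply, map_neg, eq_neg_iff_add_eq_zero]
    exact hskew Z hZ v w
  have hpos := ψ.trace_mul_adjoint_self_pos hZE hZ0
  rw [hadj, mul_neg, map_neg] at hpos
  exact neg_pos.1 hpos

/-- **The trace form is anisotropic on the centre**: a central `Z ∈ 𝔤` with `tr(Z²) = 0` vanishes.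
[cite: MoonenZarhin1999LowDim, §1] [cite: Deligne1982HodgeCycles, I §3 Prop. 3.6] -/
theorem eq_zero_of_central_of_trace_mul_self_eq_zero (H : HodgeStructure V n) (ψ : H.Polarization)
    (𝔤 : Submodule ℚ (Module.End ℚ V))
    {Θ : Module.End ℂ (ℂ ⊗[ℚ] V)} (hΘ : ∀ p, ∀ x ∈ H.piece p (n - p), Θ x = ((2 * p - n : ℤ) : ℂ) • x)
    (hΘ𝔤 : Θ ∈ spanC 𝔤)
    (hskew : ∀ X ∈ 𝔤, ∀ v w, ψ.form (X v) w + ψ.form v (X w) = 0)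
    {Z : Module.End ℚ V} (hZ : Z ∈ 𝔤) (hZc : ∀ Y ∈ 𝔤, Z * Y = Y * Z)
    (htr : LinearMap.trace ℚ V (Z * Z) = 0) : Z = 0 := by
  by_contra hZ0
  exact (trace_mul_self_lt_zero_of_central H ψ 𝔤 hΘ hΘ𝔤 hskew hZ hZc hZ0).ne htr

/-- **The centre of `𝔤` is `𝔤 ∩ End_Hdg(V)`** when `𝔤` commutes with `End_Hdg(V)` (as `Lie Hg` does): central
elements are Hodge endomorphisms (`Θ ∈ 𝔤_ℂ`), and elements of `𝔤 ∩ End_Hdg(V)` commute with `𝔤`. «`Z(Hg) ⊂ F`,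
the centre of `End⁰(X)`» (Moonen–Zarhin §1). [cite: MoonenZarhin1999LowDim, §1]
[cite: Deligne1982HodgeCycles, I §3 Prop. 3.4] -/
theorem center_eq_inf_endAlg (H : HodgeStructure V n) (𝔤 : Submodule ℚ (Module.End ℚ V))
    {Θ : Module.End ℂ (ℂ ⊗[ℚ] V)} (hΘ : ∀ p, ∀ x ∈ H.piece p (n - p), Θ x = ((2 * p - n : ℤ) : ℂ) • x)
    (hΘ𝔤 : Θ ∈ spanC 𝔤)
    (hcomm : ∀ X ∈ 𝔤, ∀ a : H.endAlg, X * (a : Module.End ℚ V) = (a : Module.End ℚ V) * X) :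
    𝔤 ⊓ Subalgebra.toSubmodule (Subalgebra.centralizer ℚ (𝔤 : Set (Module.End ℚ V))) =
      𝔤 ⊓ Subalgebra.toSubmodule H.endAlg := by
  ext Z
  rw [Literature.Algebra.Lie.TraceSeparating.mem_center_iff, Submodule.mem_inf, Subalgebra.mem_toSubmodule]
  constructor
  · rintro ⟨hZ, hZc⟩
    exact ⟨hZ, mem_endAlg_of_mem_center H 𝔤 hΘ hΘ𝔤 hZc⟩
  · rintro ⟨hZ, hZE⟩
    exact ⟨hZ, fun Y hY => (hcomm Y hY ⟨Z, hZE⟩).symm⟩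

/-! ### §3 Main theorems: `𝔤 = 𝔷(𝔤) ⊕ 𝔡(𝔤)` in effective weight one, and the case `𝔤 = Lie Hg` -/

variable [HodgeTensorFacts.{u, u}]

omit [HodgeTensorFacts.{u, u}] in
/-- **`𝔷(𝔤) ∩ 𝔡(𝔤) = 0`** for a bracket-closed rational `𝔤 ⊆ 𝔰𝔭(V, ψ)` with `Θ ∈ 𝔤_ℂ` (any weight with a
polarization; the trace form is negative definite on the centre). [cite: Deligne1982HodgeCycles, I §3 Prop. 3.6]
[cite: MoonenZarhin1999LowDim, §1] -/
theorem ThetaSubalgebra.center_inf_derived_eq_bot (H : HodgeStructure V n) (ψ : H.Polarization)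
    (𝔤 : Submodule ℚ (Module.End ℚ V))
    {Θ : Module.End ℂ (ℂ ⊗[ℚ] V)} (hΘ : ∀ p, ∀ x ∈ H.piece p (n - p), Θ x = ((2 * p - n : ℤ) : ℂ) • x)
    (hΘ𝔤 : Θ ∈ spanC 𝔤)
    (hskew : ∀ X ∈ 𝔤, ∀ v w, ψ.form (X v) w + ψ.form v (X w) = 0) :
    𝔤 ⊓ Subalgebra.toSubmodule (Subalgebra.centralizer ℚ (𝔤 : Set (Module.End ℚ V))) ⊓
      Submodule.span ℚ {B | ∃ X ∈ 𝔤, ∃ Y ∈ 𝔤, X * Y - Y * X = B} = ⊥ :=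
  Literature.Algebra.Lie.TraceSeparating.center_inf_derived_eq_bot 𝔤 fun _ hZ hZc htr =>
    eq_zero_of_central_of_trace_mul_self_eq_zero H ψ 𝔤 hΘ hΘ𝔤 hskew hZ hZc htr

/-- **`𝔤 = 𝔷(𝔤) ⊕ 𝔡(𝔤)` — a bracket-closed rational `𝔤 ⊆ 𝔰𝔭(V, ψ)` with `Θ ∈ 𝔤_ℂ` is the direct sum of its
centre and its derived algebra** (effective weight one; the sum is direct by `center_inf_derived_eq_bot`). The
Lie form of «`MT(V, h)` / `Hg` is reductive» (Deligne I 3.6; Moonen–Zarhin §1), from the separating trace form of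
`HodgeThetaSubalgebraPerfect` and the negativity of `tr(Z²)` on the centre. [cite: Deligne1982HodgeCycles, I §3 Prop. 3.6]
[cite: MoonenZarhin1999LowDim, §1] [cite: Humphreys1972, §19.1] -/
theorem ThetaSubalgebra.center_sup_derived_eq (H : HodgeStructure V n) (hn : n = 1) (heff : H.IsEffective)
    (ψ : H.Polarization) (𝔤 : Submodule ℚ (Module.End ℚ V))
    (hbr : ∀ X ∈ 𝔤, ∀ Y ∈ 𝔤, X * Y - Y * X ∈ 𝔤)
    {Θ : Module.End ℂ (ℂ ⊗[ℚ] V)} (hΘ : ∀ p, ∀ x ∈ H.piece p (n - p), Θ x = ((2 * p - n : ℤ) : ℂ) • x)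
    (hΘ𝔤 : Θ ∈ spanC 𝔤)
    (hskew : ∀ X ∈ 𝔤, ∀ v w, ψ.form (X v) w + ψ.form v (X w) = 0) :
    𝔤 ⊓ Subalgebra.toSubmodule (Subalgebra.centralizer ℚ (𝔤 : Set (Module.End ℚ V))) ⊔
      Submodule.span ℚ {B | ∃ X ∈ 𝔤, ∃ Y ∈ 𝔤, X * Y - Y * X = B} = 𝔤 :=
  Literature.Algebra.Lie.TraceSeparating.center_sup_derived_eq 𝔤 hbr
    (fun _ hX htr => eq_zero_of_forall_trace_mul_eq_zero H hn heff ψ 𝔤 hbr hΘ hΘ𝔤 hskew hX htr)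
    fun _ hZ hZc htr => eq_zero_of_central_of_trace_mul_self_eq_zero H ψ 𝔤 hΘ hΘ𝔤 hskew hZ hZc htr

/-- **`dim 𝔷(𝔤) + dim 𝔡(𝔤) = dim 𝔤`** (effective weight one). [cite: Deligne1982HodgeCycles, I §3 Prop. 3.6]
[cite: Humphreys1972, §19.1] -/
theorem ThetaSubalgebra.finrank_center_add_finrank_derived (H : HodgeStructure V n) (hn : n = 1)
    (heff : H.IsEffective) (ψ : H.Polarization) (𝔤 : Submodule ℚ (Module.End ℚ V))
    (hbr : ∀ X ∈ 𝔤, ∀ Y ∈ 𝔤, X * Y - Y * X ∈ 𝔤)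
    {Θ : Module.End ℂ (ℂ ⊗[ℚ] V)} (hΘ : ∀ p, ∀ x ∈ H.piece p (n - p), Θ x = ((2 * p - n : ℤ) : ℂ) • x)
    (hΘ𝔤 : Θ ∈ spanC 𝔤)
    (hskew : ∀ X ∈ 𝔤, ∀ v w, ψ.form (X v) w + ψ.form v (X w) = 0) :
    Module.finrank ℚ ↥(𝔤 ⊓ Subalgebra.toSubmodule (Subalgebra.centralizer ℚ (𝔤 : Set (Module.End ℚ V)))) +
      Module.finrank ℚ ↥(Submodule.span ℚ {B | ∃ X ∈ 𝔤, ∃ Y ∈ 𝔤, X * Y - Y * X = B}) =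
        Module.finrank ℚ 𝔤 :=
  Literature.Algebra.Lie.TraceSeparating.finrank_center_add_finrank_derived 𝔤 hbr
    fun _ hX htr => eq_zero_of_forall_trace_mul_eq_zero H hn heff ψ 𝔤 hbr hΘ hΘ𝔤 hskew hX htr

/-- **`𝔡(𝔤)` is perfect** (`= [𝔡(𝔤), 𝔡(𝔤)]`, effective weight one). [cite: Humphreys1972, §19.1]
[cite: Deligne1982HodgeCycles, I §3 Prop. 3.6] -/
theorem ThetaSubalgebra.derived_eq_span_commutators_derived (H : HodgeStructure V n) (hn : n = 1)
    (heff : H.IsEffective) (ψ : H.Polarization) (𝔤 : Submodule ℚ (Module.End ℚ V))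
    (hbr : ∀ X ∈ 𝔤, ∀ Y ∈ 𝔤, X * Y - Y * X ∈ 𝔤)
    {Θ : Module.End ℂ (ℂ ⊗[ℚ] V)} (hΘ : ∀ p, ∀ x ∈ H.piece p (n - p), Θ x = ((2 * p - n : ℤ) : ℂ) • x)
    (hΘ𝔤 : Θ ∈ spanC 𝔤)
    (hskew : ∀ X ∈ 𝔤, ∀ v w, ψ.form (X v) w + ψ.form v (X w) = 0) :
    Submodule.span ℚ {B | ∃ X ∈ 𝔤, ∃ Y ∈ 𝔤, X * Y - Y * X = B} =
      Submodule.span ℚ {B | ∃ X ∈ Submodule.span ℚ {B | ∃ X ∈ 𝔤, ∃ Y ∈ 𝔤, X * Y - Y * X = B},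
        ∃ Y ∈ Submodule.span ℚ {B | ∃ X ∈ 𝔤, ∃ Y ∈ 𝔤, X * Y - Y * X = B}, X * Y - Y * X = B} :=
  Literature.Algebra.Lie.TraceSeparating.derived_eq_span_commutators_derived 𝔤 hbr
    (fun _ hX htr => eq_zero_of_forall_trace_mul_eq_zero H hn heff ψ 𝔤 hbr hΘ hΘ𝔤 hskew hX htr)
    fun _ hZ hZc htr => eq_zero_of_central_of_trace_mul_self_eq_zero H ψ 𝔤 hΘ hΘ𝔤 hskew hZ hZc htr

/-- **`𝔡(𝔤)` is centre-free** (effective weight one). [cite: Humphreys1972, §19.1]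
[cite: Deligne1982HodgeCycles, I §3 Prop. 3.6] -/
theorem ThetaSubalgebra.eq_zero_of_mem_derived_of_forall_commute (H : HodgeStructure V n) (hn : n = 1)
    (heff : H.IsEffective) (ψ : H.Polarization) (𝔤 : Submodule ℚ (Module.End ℚ V))
    (hbr : ∀ X ∈ 𝔤, ∀ Y ∈ 𝔤, X * Y - Y * X ∈ 𝔤)
    {Θ : Module.End ℂ (ℂ ⊗[ℚ] V)} (hΘ : ∀ p, ∀ x ∈ H.piece p (n - p), Θ x = ((2 * p - n : ℤ) : ℂ) • x)
    (hΘ𝔤 : Θ ∈ spanC 𝔤)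
    (hskew : ∀ X ∈ 𝔤, ∀ v w, ψ.form (X v) w + ψ.form v (X w) = 0)
    {C : Module.End ℚ V} (hC : C ∈ Submodule.span ℚ {B | ∃ X ∈ 𝔤, ∃ Y ∈ 𝔤, X * Y - Y * X = B})
    (hCc : ∀ D ∈ Submodule.span ℚ {B | ∃ X ∈ 𝔤, ∃ Y ∈ 𝔤, X * Y - Y * X = B}, C * D = D * C) : C = 0 :=
  Literature.Algebra.Lie.TraceSeparating.eq_zero_of_mem_derived_of_forall_commute 𝔤 hbr
    (fun _ hX htr => eq_zero_of_forall_trace_mul_eq_zero H hn heff ψ 𝔤 hbr hΘ hΘ𝔤 hskew hX htr)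
    (fun _ hZ hZc htr => eq_zero_of_central_of_trace_mul_self_eq_zero H ψ 𝔤 hΘ hΘ𝔤 hskew hZ hZc htr) hC hCc

/-- **The trace form is non-degenerate on `𝔡(𝔤)`** (effective weight one). [cite: Humphreys1972, §5.1]
[cite: Deligne1982HodgeCycles, I §3 Prop. 3.6] -/
theorem ThetaSubalgebra.eq_zero_of_mem_derived_of_forall_trace_mul_eq_zero (H : HodgeStructure V n)
    (hn : n = 1) (heff : H.IsEffective) (ψ : H.Polarization) (𝔤 : Submodule ℚ (Module.End ℚ V))
    (hbr : ∀ X ∈ 𝔤, ∀ Y ∈ 𝔤, X * Y - Y * X ∈ 𝔤)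
    {Θ : Module.End ℂ (ℂ ⊗[ℚ] V)} (hΘ : ∀ p, ∀ x ∈ H.piece p (n - p), Θ x = ((2 * p - n : ℤ) : ℂ) • x)
    (hΘ𝔤 : Θ ∈ spanC 𝔤)
    (hskew : ∀ X ∈ 𝔤, ∀ v w, ψ.form (X v) w + ψ.form v (X w) = 0)
    {D : Module.End ℚ V} (hD : D ∈ Submodule.span ℚ {B | ∃ X ∈ 𝔤, ∃ Y ∈ 𝔤, X * Y - Y * X = B})
    (htr : ∀ D' ∈ Submodule.span ℚ {B | ∃ X ∈ 𝔤, ∃ Y ∈ 𝔤, X * Y - Y * X = B},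
      LinearMap.trace ℚ V (D * D') = 0) : D = 0 :=
  Literature.Algebra.Lie.TraceSeparating.eq_zero_of_mem_derived_of_forall_trace_mul_eq_zero 𝔤 hbr
    (fun _ hX htr => eq_zero_of_forall_trace_mul_eq_zero H hn heff ψ 𝔤 hbr hΘ hΘ𝔤 hskew hX htr)
    (fun _ hZ hZc htr => eq_zero_of_central_of_trace_mul_self_eq_zero H ψ 𝔤 hΘ hΘ𝔤 hskew hZ hZc htr) hD htr

/-! #### The case `𝔤 = Lie Hg(H) = hodgeLie H` -/

/-- `Lie Hg(H)` satisfies the standing hypotheses: it is bracket-closed, `ψ`-skew, commutes with `End_Hdg(V)`,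
and `Θ ∈ (Lie Hg)_ℂ` (the tree's `commutator_mem_hodgeLie`, `form_apply_add_eq_zero_of_mem_hodgeLie`,
`commute_of_mem_hodgeLie`, `mem_hodgeLieC_of_forall_piece`). Packaged for the instances below.
[cite: Huybrechts2016K3, Thm. 3.3.9 (proof, p. 67)] [cite: Deligne1982HodgeCycles, I §3 Prop. 3.4] -/
theorem hodgeLie_standing (H : HodgeStructure V n) (ψ : H.Polarization) :
    (∀ X ∈ H.hodgeLie, ∀ Y ∈ H.hodgeLie, X * Y - Y * X ∈ H.hodgeLie) ∧
      (∀ X ∈ H.hodgeLie, ∀ v w, ψ.form (X v) w + ψ.form v (X w) = 0) ∧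
      (∀ X ∈ H.hodgeLie, ∀ a : H.endAlg, X * (a : Module.End ℚ V) = (a : Module.End ℚ V) * X) ∧
      ∃ Θ : Module.End ℂ (ℂ ⊗[ℚ] V), (∀ p, ∀ x ∈ H.piece p (n - p), Θ x = ((2 * p - n : ℤ) : ℂ) • x) ∧
        Θ ∈ spanC H.hodgeLie := by
  obtain ⟨Θ, hΘ⟩ := exists_hodgeTheta H
  exact ⟨fun X hX Y hY => H.commutator_mem_hodgeLie hX hY,
    fun X hX v w => form_apply_add_eq_zero_of_mem_hodgeLie ψ hX v w,
    fun X hX a => H.commute_of_mem_hodgeLie hX a,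
    Θ, hΘ, by rw [← hodgeLieC_eq_spanC]; exact H.mem_hodgeLieC_of_forall_piece hΘ⟩

/-- **The centre of `Lie Hg(H)` is `Lie Hg(H) ∩ End_Hdg(V)`** (any weight): its elements are exactly the Hodge
endomorphisms lying in `Lie Hg` — `ψ`-skew for every polarization and central in `End_Hdg(V)`. «The centre of
`Hg(X)` is contained in `F^×`, `F` the centre of `End⁰(X)`» (Moonen–Zarhin §1). [cite: MoonenZarhin1999LowDim, §1]
[cite: Deligne1982HodgeCycles, I §3 Prop. 3.4] -/
theorem hodgeLie_center_eq_inf_endAlg (H : HodgeStructure V n) :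
    H.hodgeLie ⊓ Subalgebra.toSubmodule (Subalgebra.centralizer ℚ (H.hodgeLie : Set (Module.End ℚ V))) =
      H.hodgeLie ⊓ Subalgebra.toSubmodule H.endAlg := by
  obtain ⟨Θ, hΘ⟩ := exists_hodgeTheta H
  exact center_eq_inf_endAlg H H.hodgeLie hΘ
    (by rw [← hodgeLieC_eq_spanC]; exact H.mem_hodgeLieC_of_forall_piece hΘ)
    fun X hX a => H.commute_of_mem_hodgeLie hX a

/-- **`𝔷(Lie Hg) ∩ [Lie Hg, Lie Hg] = 0`** (any weight, `H` polarizable). [cite: Deligne1982HodgeCycles, I §3 Prop. 3.6]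
[cite: MoonenZarhin1999LowDim, §1] -/
theorem hodgeLie_center_inf_derived_eq_bot (H : HodgeStructure V n) (ψ : H.Polarization) :
    H.hodgeLie ⊓ Subalgebra.toSubmodule H.endAlg ⊓
      Submodule.span ℚ {B | ∃ X ∈ H.hodgeLie, ∃ Y ∈ H.hodgeLie, X * Y - Y * X = B} = ⊥ := by
  obtain ⟨-, hskew, -, Θ, hΘ, hΘ𝔤⟩ := hodgeLie_standing H ψ
  rw [← hodgeLie_center_eq_inf_endAlg]
  exact ThetaSubalgebra.center_inf_derived_eq_bot H ψ H.hodgeLie hΘ hΘ𝔤 hskew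

/-- **`Lie Hg(H) = (Lie Hg(H) ∩ End_Hdg(V)) ⊕ [Lie Hg(H), Lie Hg(H)]` — the Lie algebra of the Hodge group of an
effective polarizable weight-one Hodge structure is reductive: centre plus derived algebra** (Deligne I 3.6;
Moonen–Zarhin §1; the sum is direct by `hodgeLie_center_inf_derived_eq_bot`). [cite: Deligne1982HodgeCycles, I §3 Prop. 3.6]
[cite: MoonenZarhin1999LowDim, §1] [cite: Humphreys1972, §19.1] -/
theorem hodgeLie_center_sup_derived_eq (H : HodgeStructure V n) (hn : n = 1) (heff : H.IsEffective)
    (ψ : H.Polarization) :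
    H.hodgeLie ⊓ Subalgebra.toSubmodule H.endAlg ⊔
      Submodule.span ℚ {B | ∃ X ∈ H.hodgeLie, ∃ Y ∈ H.hodgeLie, X * Y - Y * X = B} = H.hodgeLie := by
  obtain ⟨hbr, hskew, -, Θ, hΘ, hΘ𝔤⟩ := hodgeLie_standing H ψ
  rw [← hodgeLie_center_eq_inf_endAlg]
  exact ThetaSubalgebra.center_sup_derived_eq H hn heff ψ H.hodgeLie hbr hΘ hΘ𝔤 hskew

/-- **`dim Lie Hg(H) = dim (Lie Hg(H) ∩ End_Hdg(V)) + dim [Lie Hg(H), Lie Hg(H)]`** (effective weight one).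
[cite: Deligne1982HodgeCycles, I §3 Prop. 3.6] [cite: Humphreys1972, §19.1] -/
theorem finrank_hodgeLie_eq_center_add_derived (H : HodgeStructure V n) (hn : n = 1) (heff : H.IsEffective)
    (ψ : H.Polarization) :
    Module.finrank ℚ H.hodgeLie =
      Module.finrank ℚ ↥(H.hodgeLie ⊓ Subalgebra.toSubmodule H.endAlg) +
        Module.finrank ℚ ↥(Submodule.span ℚ {B | ∃ X ∈ H.hodgeLie, ∃ Y ∈ H.hodgeLie, X * Y - Y * X = B}) := by
  obtain ⟨hbr, hskew, -, Θ, hΘ, hΘ𝔤⟩ := hodgeLie_standing H ψ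
  rw [← hodgeLie_center_eq_inf_endAlg]
  exact (ThetaSubalgebra.finrank_center_add_finrank_derived H hn heff ψ H.hodgeLie hbr hΘ hΘ𝔤 hskew).symm

/-- **`[Lie Hg, Lie Hg]` is perfect** (effective weight one). [cite: Humphreys1972, §19.1]
[cite: Deligne1982HodgeCycles, I §3 Prop. 3.6] -/
theorem hodgeLie_derived_perfect (H : HodgeStructure V n) (hn : n = 1) (heff : H.IsEffective)
    (ψ : H.Polarization) :
    Submodule.span ℚ {B | ∃ X ∈ H.hodgeLie, ∃ Y ∈ H.hodgeLie, X * Y - Y * X = B} =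
      Submodule.span ℚ {B | ∃ X ∈ Submodule.span ℚ {B | ∃ X ∈ H.hodgeLie, ∃ Y ∈ H.hodgeLie, X * Y - Y * X = B},
        ∃ Y ∈ Submodule.span ℚ {B | ∃ X ∈ H.hodgeLie, ∃ Y ∈ H.hodgeLie, X * Y - Y * X = B},
          X * Y - Y * X = B} := by
  obtain ⟨hbr, hskew, -, Θ, hΘ, hΘ𝔤⟩ := hodgeLie_standing H ψ
  exact ThetaSubalgebra.derived_eq_span_commutators_derived H hn heff ψ H.hodgeLie hbr hΘ hΘ𝔤 hskew

/-- **`[Lie Hg, Lie Hg]` is centre-free** (effective weight one). [cite: Humphreys1972, §19.1]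
[cite: Deligne1982HodgeCycles, I §3 Prop. 3.6] -/
theorem hodgeLie_derived_center_trivial (H : HodgeStructure V n) (hn : n = 1) (heff : H.IsEffective)
    (ψ : H.Polarization) {C : Module.End ℚ V}
    (hC : C ∈ Submodule.span ℚ {B | ∃ X ∈ H.hodgeLie, ∃ Y ∈ H.hodgeLie, X * Y - Y * X = B})
    (hCc : ∀ D ∈ Submodule.span ℚ {B | ∃ X ∈ H.hodgeLie, ∃ Y ∈ H.hodgeLie, X * Y - Y * X = B}, C * D = D * C) :
    C = 0 := by
  obtain ⟨hbr, hskew, -, Θ, hΘ, hΘ𝔤⟩ := hodgeLie_standing H ψ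
  exact ThetaSubalgebra.eq_zero_of_mem_derived_of_forall_commute H hn heff ψ H.hodgeLie hbr hΘ hΘ𝔤 hskew hC hCc

/-- **The trace form of `V` is non-degenerate on `[Lie Hg, Lie Hg]`** (effective weight one).
[cite: Humphreys1972, §5.1] [cite: Deligne1982HodgeCycles, I §3 Prop. 3.6] -/
theorem hodgeLie_derived_trace_separating (H : HodgeStructure V n) (hn : n = 1) (heff : H.IsEffective)
    (ψ : H.Polarization) {D : Module.End ℚ V}
    (hD : D ∈ Submodule.span ℚ {B | ∃ X ∈ H.hodgeLie, ∃ Y ∈ H.hodgeLie, X * Y - Y * X = B})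
    (htr : ∀ D' ∈ Submodule.span ℚ {B | ∃ X ∈ H.hodgeLie, ∃ Y ∈ H.hodgeLie, X * Y - Y * X = B},
      LinearMap.trace ℚ V (D * D') = 0) : D = 0 := by
  obtain ⟨hbr, hskew, -, Θ, hΘ, hΘ𝔤⟩ := hodgeLie_standing H ψ
  exact ThetaSubalgebra.eq_zero_of_mem_derived_of_forall_trace_mul_eq_zero H hn heff ψ H.hodgeLie hbr hΘ hΘ𝔤
    hskew hD htr

/-- **`Lie Hg(H)` is abelian iff `[Lie Hg, Lie Hg] = 0` iff `Lie Hg ⊆ End_Hdg(V)`** — the CM criterion read on the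
decomposition (effective weight one): `𝔡 = 0` forces `Lie Hg = 𝔷 ⊆ End_Hdg(V)`, and conversely `Lie Hg ⊆ End_Hdg`
makes `Lie Hg` central in itself (it commutes with `End_Hdg`). [cite: MoonenZarhin1999LowDim, §1]
[cite: Deligne1982HodgeCycles, I §3 Prop. 3.6] -/
theorem hodgeLie_derived_eq_bot_iff_le_endAlg (H : HodgeStructure V n) (hn : n = 1) (heff : H.IsEffective)
    (ψ : H.Polarization) :
    Submodule.span ℚ {B | ∃ X ∈ H.hodgeLie, ∃ Y ∈ H.hodgeLie, X * Y - Y * X = B} = ⊥ ↔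
      H.hodgeLie ≤ Subalgebra.toSubmodule H.endAlg := by
  constructor
  · intro h
    have hsup := hodgeLie_center_sup_derived_eq H hn heff ψ
    rw [h, sup_bot_eq] at hsup
    rw [← hsup]
    exact inf_le_right
  · intro h
    rw [Submodule.eq_bot_iff]
    intro B hB
    induction hB using Submodule.span_induction with
    | mem B hB =>
      obtain ⟨X, hX, Y, hY, rfl⟩ := hB
      have hYE : Y ∈ H.endAlg := h hY
      have hc : X * Y = Y * X := H.commute_of_mem_hodgeLie hX ⟨Y, hYE⟩
      rw [hc, sub_self]
    | zero => rfl
    | add B B' _ _ hB hB' => rw [hB, hB', add_zero]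
    | smul c B _ hB => rw [hB, smul_zero]

end Hodge

end HodgeStructure

end Literature.AlgebraicGeometry.Motives

end
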